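import Summits.CriticalPhenomena.PercolationContinuityZ3.Theorems.Transplant.KNCells2FacePrefixO
import Summits.CriticalPhenomena.PercolationContinuityZ3.Theorems.Transplant.KNCells2FacePrefix
import Summits.CriticalPhenomena.PercolationContinuityZ3.Theorems.Transplant.KNCells2CorridorO
import Summits.CriticalPhenomena.PercolationContinuityZ3.Theorems.Transplant.KNCells2Corridor
import Summits.CriticalPhenomena.PercolationContinuityZ3.Theorems.Transplant.KNCellsSchemeO
import Summits.CriticalPhenomena.PercolationContinuityZ3.Theorems.Transplant.KNCellsProcessO
import Summits.CriticalPhenomena.PercolationContinuityZ3.Theorems.Transplant.KNCellsRunO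
import Summits.CriticalPhenomena.PercolationContinuityZ3.Theorems.Transplant.KNCellsRunInvO
import Summits.CriticalPhenomena.PercolationContinuityZ3.Theorems.Transplant.KNCells2SchemeO
import Summits.CriticalPhenomena.PercolationContinuityZ3.Theorems.Transplant.KNCells2RunO
import Summits.CriticalPhenomena.PercolationContinuityZ3.Theorems.Transplant.KNCells2RunInvO
import Summits.CriticalPhenomena.PercolationContinuityZ3.Theorems.Transplant.KNCellsCoverO
import Summits.CriticalPhenomena.PercolationContinuityZ3.Theorems.Transplant.KNCells2CoverO
import Summits.CriticalPhenomena.PercolationContinuityZ3.Theorems.Transplant.KNCellsStepsDefsO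
import Summits.CriticalPhenomena.PercolationContinuityZ3.Theorems.Transplant.KNCellsStepsReachO
import Summits.CriticalPhenomena.PercolationContinuityZ3.Theorems.Transplant.KNCellsStepsPinO
import Summits.CriticalPhenomena.PercolationContinuityZ3.Theorems.Transplant.KNCellsStepsSubboxO
import Summits.CriticalPhenomena.PercolationContinuityZ3.Theorems.Transplant.KNCells2SepQ
import Literature.Probability.Percolation.OrientedHistorySiteRenormalizationRun
import HarnessLib

/-!
# N2 (frames-only node `SamePDropOfSkeletonFrm₁`, OPEN) — ORIENTED MACRO LAYER (WAVE 0 (c1), (R-18) `q ≡ true`): the oriented twin of N1's `KNCells2SepQ`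

builds on p205010 (kernel theorem, internal audit signed; external expert review pending) — nothing in this file uses p205010; NOTHING is claimed about the
open node `SamePDropOfSkeletonFrm₁` (`SamePDropOfSkeletonNeg₁` is CLOSED in the tree and untouched by this file).
Status sentence (coordinator 2026-08-20T04:30Z): "θ(p_c) = 0 on ℤ^d, all d ≥ 2 — kernel-verified (Lean 4/Mathlib, standard axioms); internal adversarial
audit SIGNED 2026-08-20 04:29Z; external expert review pending."
Lane `prim-bschramm-*`, seat `prim-bschramm-stmt` (gen 19); helper file (`--supports stmt-CriticalPhenomena-4575 --as helper`); N2-SCOPE §20, (R-18)/(R-19).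
PORT RULES (HOME/prim-bschramm-stmt-g19/lean/port_orient.py): the history-site API is replaced by its ORIENTED twin at the fixed quadrant `qNE := fun _ => true`
(`HState.choice ↦ HState.ochoice qNE`, `mstOf ↦ omstOf qNE`, `mst/stN ↦ omst/ostN qNE`, `occFinal ↦ ooccFinal qNE`, `Lawful ↦ OLawful qNE`, onward directions
`onward ↦ onwardO` = the POSITIVE ones, (N2-e)); every declaration whose text changes thereby — directly or through a changed declaration — is re-declared with the
suffix `O` (same namespace); unchanged declarations of the N1 file are NOT repeated (the N1 module is imported). Docstrings/citations are N1's.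
N1 HEADER (kept for the reader):
* `QSepGeom G Γ` — the two separation facts of the cube: cells of other macro-vertices and all stub zones of other macro-vertices are
  `G`-separated from `Q_a x` (p3-g2's planar `Cell_sep_Q` / `Zone_sep_Q`, all anchors);
* **`Valid₂.sep_Q`** (`Sep G (Vx h) (Q a (tgt e))`), **`Valid₂.sep_habitat`** (`Sep G (Vx h) (Q a (tgt e) ∪ Efar a' (tgt e) du)` for onward `du`);
* corollaries for a fresh region `Dd ⊆ Q_a(x) ∪ Efar_{a'}(x,du)`: `disjoint_Vx_of_fresh`, `root_not_mem_of_fresh`, **`mem_of_adj_fresh`** (a vertex of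
  `Ucor = Vx ∪ E_{v,x} ∪ H_{x,y}` adjacent to `Dd` lies in `E_{v,x} ∪ H_{x,y}`), `mem_Sx_of_adj_fresh` (likewise for `Sx`: in `E_{v,x} ∪ E^far`).
[cite: KozmaNitzan2024, §4 p. 26 ((29)), p. 31 ((31))]
-/
noncomputable section

open MeasureTheory ProbabilityTheory
open scoped ENNReal Classical

namespace Summit.CriticalPhenomena.PercolationContinuityZ3.Theorems

namespace Transplant

namespace KNCells

open Literature.Probability.Percolation Literature.Probability.LatticeModels SimpleGraph GadgetSystem ProbeHistory HSiteScheme Contour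

variable {V : Type*} [DecidableEq V]

namespace KSchA

variable {A : Type*} {G : SimpleGraph V} [G.LocallyFinite] {S : KSchA V A} {FD : FaceData V A} {LD : LevelData V A}
variable (hL : LevelGeom G S.Γ FD LD) (hQ : QSepGeom G S.Γ)
variable {h : ProbeHistory V} {e : Site 2 × MDir} (hV : S.Valid₂O G h e) {a a' : A} {du : MDir} (hdu : du ∈ S.onwardO G h (tgt e))
include hV

section SepQ

include hQ

/-- **After a valid history the explored region is separated from the cube `Q_a(x)` of the examined `x = tgt e`** (any anchor).
[cite: KozmaNitzan2024, §4 p. 26 ((29))] -/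
theorem Valid₂O.sep_Q (a : A) : ((Sep G (S.Vx G h) (S.Γ.Q a (tgt e))) : Prop) := by
  intro y hy b hb
  obtain ⟨det, hv, -, hsub⟩ := hV.cover
  have hy' := hsub (Finset.mem_coe.2 hy)
  simp only [CellGeom.Cover, Set.mem_iUnion, Set.mem_union, exists_prop, Finset.mem_coe] at hy'
  obtain ⟨u, hu, h' | ⟨δ', h'⟩⟩ := hy'
  · have huv : u ≠ tgt e := fun h'' => hv (h'' ▸ hu)
    exact hQ.Cell_sep_Q _ _ _ _ huv y h' b hb
  · have huv : u ≠ tgt e := fun h'' => hv (h'' ▸ hu)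
    exact hQ.Zone_sep_Q _ _ _ _ _ huv y h' b hb

include hL hdu

/-- **The explored region is separated from the fresh habitat `Q_a(x) ∪ E^far_{a'}(x, du)`** (onward `du`). [cite: KozmaNitzan2024, §4 pp. 26, 31] -/
theorem Valid₂O.sep_habitat : ((Sep G (S.Vx G h) (S.Γ.Q a (tgt e) ∪ S.Γ.Efar a' (tgt e) du)) : Prop) := by
  intro y hy b hb
  rcases Finset.mem_union.1 hb with hb | hb
  · exact Valid₂O.sep_Q hQ hV a y hy b hb
  · exact Valid₂O.sep_Efar hL hV hdu y hy b hb

/-- A fresh region inside the habitat is disjoint from the explored region. [folklore] -/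
theorem disjoint_Vx_of_freshO {Dd : Finset V} (hD : Dd ⊆ S.Γ.Q a (tgt e) ∪ S.Γ.Efar a' (tgt e) du) : ((Disjoint Dd (S.Vx G h)) : Prop) := by
  rw [Finset.disjoint_left]
  intro v hv hvV
  exact (Valid₂O.sep_habitat hL hQ hV hdu v hvV v (hD hv)).1 rfl

/-- The root lies outside every fresh region inside the habitat. [folklore] -/
theorem root_not_mem_of_freshO {Dd : Finset V} (hD : Dd ⊆ S.Γ.Q a (tgt e) ∪ S.Γ.Efar a' (tgt e) du) : ((S.Γ.root ∉ Dd) : Prop) := fun h' =>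
  Finset.disjoint_left.1 (disjoint_Vx_of_freshO hL hQ hV hdu hD) h' hV.root_mem

/-- **A vertex of the corridor world `Ucor = Vx ∪ E_{v,x} ∪ H_{x,y}` adjacent to a fresh region inside the habitat lies in `E_{v,x} ∪ H_{x,y}`**
(the generic half of the subbox side-condition in the tube graph). [cite: KozmaNitzan2024, §4 p. 31] -/
theorem mem_of_adj_freshO {Dd : Finset V} (hD : Dd ⊆ S.Γ.Q a (tgt e) ∪ S.Γ.Efar a' (tgt e) du) {b : A} {v x : V} (hv : v ∈ Dd)
    (hx : x ∈ S.Ucor G FD h e b a' du) (hadj : G.Adj x v) : ((x ∈ S.Γ.Ewv b e.1 e.2 ∪ FD.Hfull a' (tgt e) du) : Prop) := by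
  rw [Ucor, Finset.mem_union, Finset.mem_union] at hx
  rcases hx with (hx | hx) | hx
  · exact absurd hadj (Valid₂O.sep_habitat hL hQ hV hdu x hx v (hD hv)).2
  · exact Finset.mem_union_left _ hx
  · exact Finset.mem_union_right _ hx

/-- Likewise for the support `Sx = Vx ∪ E_{v,x} ∪ E^far`: a vertex of `Sx` adjacent to a fresh region lies in `E_{v,x} ∪ E^far`. [folklore] -/
theorem mem_Sx_of_adj_freshO {Dd : Finset V} (hD : Dd ⊆ S.Γ.Q a (tgt e) ∪ S.Γ.Efar a' (tgt e) du) {b : A} {v x : V} (hv : v ∈ Dd)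
    (hx : x ∈ S.Sx G h e b a' du) (hadj : G.Adj x v) : ((x ∈ S.Γ.Ewv b e.1 e.2 ∪ S.Γ.Efar a' (tgt e) du) : Prop) := by
  rw [Sx, Finset.mem_union, Finset.mem_union] at hx
  rcases hx with (hx | hx) | hx
  · exact absurd hadj (Valid₂O.sep_habitat hL hQ hV hdu x hx v (hD hv)).2
  · exact Finset.mem_union_left _ hx
  · exact Finset.mem_union_right _ hx

end SepQ

end KSchA

end KNCells

end Transplant

end Summit.CriticalPhenomena.PercolationContinuityZ3.Theorems

end
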